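import Summits.QuantumFields.YangMills.Theorems.FemtoCurvatureTwoPoint.Negative.FiniteGroupBounds
import Literature.Barriers.QuantumFields.DiscreteSubgroupFreezing

/-!
# `FemtoCurvatureTwoPoint`, line `generic-step-gamma-encoding`: the stub `stub_axisLower`
# (`AxisLowerFixedTorus`) is FALSE once `IsCompactSimpleLieGroup G` is weakened to `Nontrivial G`

Negative-side lemma for crux `Summit.QuantumFields.YangMills.Theses.LangevinControlUV.
FemtoCurvatureTwoPoint` (item stmt-QuantumFields-9363), drefute of the picked line
`Cruxes/FemtoCurvatureTwoPoint/Lines/generic-step-gamma-encoding.lean`.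

The line's hardest stub concludes `AxisLowerFixedTorus`: for every compact simple Lie `G` and
faithful unitary `r`, per-torus thresholds `B(L)` and ONE `c > 0` with
`c ≤ β² n⁸ Cov_{L,β}(P_0^{01}, P_{ne₂}^{01})` for `β ≥ B(L)`, `1 ≤ n`, `8n ≤ L`.

* `eventually_axisCov_le` — for a finite abelian non-trivial `G` with a faithful unitary `ρ`, on
  the torus `(ℤ/8)⁴`: `Cov_β(P_0^{01}, P_{e₂}^{01}) ≤ M e^{-8βδ}` for all large `β` (`δ` the action
  gap; the two-vortex Peierls bound `sum_Img_axis_le` of `Negative.FiniteGroupBounds`, with the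
  partition-function bookkeeping of `Negative.FiniteGroupRatio`).
* `not_axisLowerFixedTorus_nontrivial` — the stub's conclusion with `IsCompactSimpleLieGroup G`
  weakened to `Nontrivial G` (everything else verbatim) is FALSE: witness the group of
  square roots of unity `rootsOfUnityCircle 2 ≅ ℤ₂` with its defining character `znRep 2`
  (`Literature.Barriers.QuantumFields.DiscreteSubgroupFreezing`): at `L = 8`, `n = 1` the stub
  demands `c ≤ β² Cov_β ≤ β² M e^{-8βδ} → 0`.

So `ConnectedSpace G` (inside `IsSimpleCompactGroup`) is load-bearing for `stub_axisLower`, by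
the same exponential freezing that kills the `Nontrivial` variant of the crux itself.
-/

noncomputable section

open Finset Function Filter Topology
open Literature.MathematicalPhysics.QuantumFieldTheory
open Literature.MathematicalPhysics.QuantumFieldTheory.LatticeForm
open Literature.Probability.LatticeModels (rcomponent rcomponents)
open Literature.Barriers.QuantumFields
open Summit.QuantumFields.YangMills.Theorems.FemtoCurvatureTwoPoint.Negative.FiniteGroupPeierls
open Summit.QuantumFields.YangMills.Theorems.FemtoCurvatureTwoPoint.Negative.FiniteGroupVortices
open Summit.QuantumFields.YangMills.Theorems.FemtoCurvatureTwoPoint.Negative.FiniteGroupTwoPlaquettes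
open Summit.QuantumFields.YangMills.Theorems.FemtoCurvatureTwoPoint.Negative.FiniteGroupBounds

namespace Summit.QuantumFields.YangMills.Theorems.FemtoCurvatureTwoPoint.Negative.AxisLowerFiniteGroup

/- At the concrete torus `L = 8` the unifier must never unfold the finsets over all plaquettes /
configurations. -/
attribute [local irreducible] psupp Closed Fib connSets Wt Img

section Finite

variable {G : Type} [CommGroup G] [Fintype G] [DecidableEq G] [TopologicalSpace G]
  [DiscreteTopology G] [IsTopologicalGroup G] [MeasurableSpace G] [BorelSpace G] {N : ℕ}
  (ρ : G →* Matrix (Fin N) (Fin N) ℂ)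

/-- **Exponential freezing of the axis covariance for a finite abelian gauge group.** On
`(ℤ/8)⁴`, for all large `β`: `Cov_β(P_0^{01}, P_{e₂}^{01}) ≤ M e^{-8βδ}` (in fact already
`E_β[P_0^{01} P_{e₂}^{01}] ≤ M ε⁸`, `ε = e^{-βδ}`, `δ` the action gap of `ρ`). -/
theorem eventually_axisCov_le [Nontrivial G] (hρu : ∀ g, ρ g ∈ Matrix.unitaryGroup (Fin N) ℂ)
    (hρinj : Function.Injective ρ) :
    ∃ (M δ : ℝ), 0 < δ ∧ ∀ᶠ β : ℝ in atTop,
      wilsonExpectation (d := 4) (L := 8) ρ β (fun U =>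
            ((N : ℝ) - (ρ (plaquetteHolonomy U (0 : Site 4 8) 0 1)).trace.re) *
              ((N : ℝ) - (ρ (plaquetteHolonomy U (Pi.single (2 : Fin 4) (((1 : ℕ) : ℕ) : ZMod 8))
                0 1)).trace.re)) -
          wilsonExpectation (d := 4) (L := 8) ρ β
              (fun U => (N : ℝ) - (ρ (plaquetteHolonomy U (0 : Site 4 8) 0 1)).trace.re) *
            wilsonExpectation (d := 4) (L := 8) ρ β (fun U => (N : ℝ) -
              (ρ (plaquetteHolonomy U (Pi.single (2 : Fin 4) (((1 : ℕ) : ℕ) : ZMod 8)) 0 1)).trace.re)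
        ≤ M * Real.exp (-(β * δ)) ^ 8 := by
  classical
  -- the minimal action gap `δ = N - Re tr ρ(g₀)` over `g ≠ 1`, attained at `g₀`
  obtain ⟨g₀, hg₀, hmin⟩ := Finset.exists_min_image (Finset.univ.filter fun g : G => g ≠ 1)
    (fun g => (N : ℝ) - (ρ g).trace.re) (by
      obtain ⟨a, ha⟩ := exists_ne (1 : G)
      exact ⟨a, Finset.mem_filter.2 ⟨Finset.mem_univ _, ha⟩⟩)
  have hg₀1 : g₀ ≠ 1 := (Finset.mem_filter.1 hg₀).2
  set δ : ℝ := (N : ℝ) - (ρ g₀).trace.re with hδ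
  have hgap : ∀ g : G, g ≠ 1 → δ ≤ (N : ℝ) - (ρ g).trace.re := fun g hg =>
    hmin g (Finset.mem_filter.2 ⟨Finset.mem_univ _, hg⟩)
  have hδ0 : 0 < δ := by
    rcases (gap_mem ρ hρu g₀).1.lt_or_eq with h | h
    · exact h
    · exfalso
      have htr : (ρ g₀).trace.re = N := by linarith
      have h1 := Literature.Barriers.QuantumFields.eq_one_of_re_trace_eq (hρu g₀) htr
      exact hg₀1 (hρinj (by rw [h1, map_one]))
  -- constants
  set Pc : ℝ := ((Fintype.card (Plaquette 4 8) : ℕ) : ℝ) with hPc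
  set A : ℝ := ((Fintype.card (Additive G) : ℕ) : ℝ) with hA
  set T : ℝ := 1 / (2 * (((cubeDeg 4 : ℝ) + 1) ^ 2)) with hT
  have hD0 : (0 : ℝ) < ((cubeDeg 4 : ℝ) + 1) ^ 2 := pow_pos (Nat.cast_add_one_pos _) 2
  have hT0 : 0 < T := by rw [hT]; exact one_div_pos.2 (mul_pos two_pos hD0)
  have hsmallT : ((cubeDeg 4 : ℝ) + 1) ^ 2 * T ≤ 1 / 2 := by
    rw [hT, mul_one_div, div_le_iff₀ (mul_pos two_pos hD0)]; nlinarith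
  have hPc0 : 0 ≤ Pc := Nat.cast_nonneg _
  have hA1 : 1 ≤ A := by
    rw [hA]; exact_mod_cast Fintype.card_pos
  have hA0 : 0 ≤ A := by linarith
  have hApos : 0 < A := by linarith
  have hN0 : (0 : ℝ) ≤ N := Nat.cast_nonneg N
  set C5 : ℝ := Pc * (2 * T) / T ^ 5 with hC5
  set C8 : ℝ := Pc * (2 * T) / T ^ 8 with hC8
  have hC50 : 0 ≤ C5 := div_nonneg (mul_nonneg hPc0 (by linarith)) (pow_nonneg hT0.le _)
  have hC80 : 0 ≤ C8 := div_nonneg (mul_nonneg hPc0 (by linarith)) (pow_nonneg hT0.le _)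
  have hT0' : T ≠ 0 := hT0.ne'
  have hA' : A ≠ 0 := hApos.ne'
  have hPc1 : Pc + 1 ≠ 0 := by linarith
  -- freeze the constants (no unfolding of cardinalities below)
  clear_value Pc A T C5 C8
  refine ⟨8 * (N : ℝ) ^ 2 * (C8 * A ^ 8 + C5 ^ 2 * A ^ 10), δ, hδ0, ?_⟩
  -- `ε(β) = e^{-βδ} → 0`
  have hεt : Tendsto (fun β : ℝ => Real.exp (-(β * δ))) atTop (𝓝 0) := by
    have h1 : Tendsto (fun β : ℝ => -(β * δ)) atTop atBot :=
      tendsto_neg_atTop_atBot.comp (tendsto_id.atTop_mul_const hδ0)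
    exact Real.tendsto_exp_atBot.comp h1
  have hev1 : ∀ᶠ β : ℝ in atTop, 0 ≤ β := eventually_ge_atTop 0
  have hPA : 0 < 4 * (Pc + 1) * A := mul_pos (by linarith) hApos
  have hev2 : ∀ᶠ β : ℝ in atTop, Real.exp (-(β * δ)) < T / A :=
    hεt (Iio_mem_nhds (div_pos hT0 hApos))
  have hev3 : ∀ᶠ β : ℝ in atTop, Real.exp (-(β * δ)) < 1 / (4 * (Pc + 1) * A) :=
    hεt (Iio_mem_nhds (one_div_pos.2 hPA))
  filter_upwards [hev1, hev2, hev3] with β hβ hε2 hε3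
  -- abbreviations at this `β`
  set ε : ℝ := Real.exp (-(β * δ)) with hε
  have hε0 : 0 < ε := Real.exp_pos _
  have hε1 : ε ≤ 1 := Real.exp_le_one_iff.2 (by nlinarith)
  set φ : Additive G → ℝ := wilsonPhi ρ β with hφ
  have hφ0 : φ 0 = 1 := wilsonPhi_zero ρ β
  have hφn : ∀ a, 0 ≤ φ a := wilsonPhi_nonneg ρ β
  have hφε : ∀ a, a ≠ 0 → φ a ≤ ε := wilsonPhi_le_of_gap ρ hβ hgap
  set lam : ℝ := A * ε with hlam
  have hlam0 : 0 ≤ lam := mul_nonneg hA0 hε0.le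
  have hlamT : lam ≤ T := by
    rw [hlam]; have := (lt_div_iff₀ hApos).1 hε2; linarith [mul_comm A ε]
  -- Peierls sums
  have hPS : ∀ M : ℕ, peierlsSum 4 8 lam M ≤ Pc * (2 * T) * (lam / T) ^ M := fun M => by
    have h := peierlsSum_le_pow (d := 4) (L := 8) hlam0 hlamT hT0 hsmallT M
    rwa [← hPc] at h
  have hlam_lt : lam < 1 / (4 * (Pc + 1)) := by
    rw [hlam]
    calc A * ε < A * (1 / (4 * (Pc + 1) * A)) := mul_lt_mul_of_pos_left hε3 hApos
      _ = 1 / (4 * (Pc + 1)) := by field_simp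
  have hPS1 : peierlsSum 4 8 lam 1 ≤ 1 / 2 := by
    refine (hPS 1).trans ?_
    have h1 : Pc * (2 * T) * (lam / T) ^ 1 = 2 * Pc * lam := by rw [pow_one]; field_simp
    rw [h1]
    have h2 : 2 * Pc * lam ≤ 2 * (Pc + 1) * lam := by nlinarith
    have h3 : 2 * (Pc + 1) * lam < 2 * (Pc + 1) * (1 / (4 * (Pc + 1))) :=
      mul_lt_mul_of_pos_left hlam_lt (by linarith)
    have h4 : 2 * (Pc + 1) * (1 / (4 * (Pc + 1))) = 1 / 2 := by field_simp; ring
    linarith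
  have hPS5 : peierlsSum 4 8 lam 5 ≤ C5 * lam ^ 5 := by
    refine (hPS 5).trans (le_of_eq ?_)
    rw [hC5, div_pow, div_mul_eq_mul_div, mul_div_assoc]
  have hPS8 : peierlsSum 4 8 lam 8 ≤ C8 * lam ^ 8 := by
    refine (hPS 8).trans (le_of_eq ?_)
    rw [hC8, div_pow, div_mul_eq_mul_div, mul_div_assoc]
  have hPS50 : 0 ≤ peierlsSum 4 8 lam 5 := peierlsSum_nonneg hlam0 5
  -- partition sums
  have hPS1' : peierlsSum 4 8 (Fintype.card (Additive G) * ε) 1 ≤ 1 / 2 := by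
    rw [← hA, ← hlam]; exact hPS1
  have hZc2 : ∑ η ∈ Closed 4 8 (Additive G), Wt φ η ≤ 2 :=
    sum_closed_le_two hφ0 hφn hε0.le hφε hPS1'
  have hZex1 : 1 ≤ ∑ η ∈ Img 4 8 G, Wt φ η := one_le_sum_Img hφ0 hφn
  have hZex0 : 0 < ∑ η ∈ Img 4 8 G, Wt φ η := by linarith only [hZex1]
  -- rewrite the three expectations through the plaquette field
  have hsing : (Pi.single (2 : Fin 4) (((1 : ℕ) : ℕ) : ZMod 8) : Site 4 8) = te 2 := by
    simp [te]
  simp only [hsing]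
  have eP0P1 : (fun U : GaugeConfig 4 8 G =>
      ((N : ℝ) - (ρ (plaquetteHolonomy U (0 : Site 4 8) 0 1)).trace.re) *
        ((N : ℝ) - (ρ (plaquetteHolonomy U (te 2 : Site 4 8) 0 1)).trace.re)) =
      fun U => (fun η : Plaquette 4 8 → Additive G =>
        ((N : ℝ) - (ρ (Additive.toMul (η ((0 : Site 4 8), ⟨(0, 1), h01⟩)))).trace.re) *
          ((N : ℝ) - (ρ (Additive.toMul (η ((te 2 : Site 4 8), ⟨(0, 1), h01⟩)))).trace.re))
        (plaqField U) := by
    funext U; simp only [plaqField_apply, toMul_ofMul]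
  have eP0 : (fun U : GaugeConfig 4 8 G =>
      (N : ℝ) - (ρ (plaquetteHolonomy U (0 : Site 4 8) 0 1)).trace.re) =
      fun U => (fun η : Plaquette 4 8 → Additive G =>
        (N : ℝ) - (ρ (Additive.toMul (η ((0 : Site 4 8), ⟨(0, 1), h01⟩)))).trace.re) (plaqField U) := by
    funext U; simp only [plaqField_apply, toMul_ofMul]
  have eP1 : (fun U : GaugeConfig 4 8 G =>
      (N : ℝ) - (ρ (plaquetteHolonomy U (te 2 : Site 4 8) 0 1)).trace.re) =
      fun U => (fun η : Plaquette 4 8 → Additive G =>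
        (N : ℝ) - (ρ (Additive.toMul (η ((te 2 : Site 4 8), ⟨(0, 1), h01⟩)))).trace.re)
        (plaqField U) := by
    funext U; simp only [plaqField_apply, toMul_ofMul]
  rw [eP0P1, eP0, eP1]
  -- torus Wilson expectations of functions of the plaquette field are exact-ensemble averages
  have hW : ∀ f : (Plaquette 4 8 → Additive G) → ℝ,
      wilsonExpectation (d := 4) (L := 8) ρ β (fun U => f (plaqField U)) =
        (∑ η ∈ Img 4 8 G, Wt (wilsonPhi ρ β) η * f η) / ∑ η ∈ Img 4 8 G, Wt (wilsonPhi ρ β) η :=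
    fun f => by
      rw [wilsonExpectation_eq_gibbsAverage ρ continuous_of_discreteTopology β,
        gibbsAverage_eq_exactAvgR (wilsonPhi ρ β) (w := fun U => Real.exp (-β * wilsonAction ρ U))
          (fun U => exp_neg_mul_wilsonAction ρ β U) f]
      rfl
  rw [hW (fun η : Plaquette 4 8 → Additive G =>
        ((N : ℝ) - (ρ (Additive.toMul (η ((0 : Site 4 8), ⟨(0, 1), h01⟩)))).trace.re) *
          ((N : ℝ) - (ρ (Additive.toMul (η ((te 2 : Site 4 8), ⟨(0, 1), h01⟩)))).trace.re)),
    hW (fun η : Plaquette 4 8 → Additive G =>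
        (N : ℝ) - (ρ (Additive.toMul (η ((0 : Site 4 8), ⟨(0, 1), h01⟩)))).trace.re),
    hW (fun η : Plaquette 4 8 → Additive G =>
        (N : ℝ) - (ρ (Additive.toMul (η ((te 2 : Site 4 8), ⟨(0, 1), h01⟩)))).trace.re)]
  -- the numerators and their bounds
  set Zex := ∑ η ∈ Img 4 8 G, Wt φ η with hZexdef
  set Zc := ∑ η ∈ Closed 4 8 (Additive G), Wt φ η with hZcdef
  set nA := ∑ η ∈ Img 4 8 G, Wt φ η *
    (((N : ℝ) - (ρ (Additive.toMul (η ((0 : Site 4 8), ⟨(0, 1), h01⟩)))).trace.re) *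
      ((N : ℝ) - (ρ (Additive.toMul (η ((te 2 : Site 4 8), ⟨(0, 1), h01⟩)))).trace.re)) with hnAdef
  set n0 := ∑ η ∈ Img 4 8 G, Wt φ η *
    ((N : ℝ) - (ρ (Additive.toMul (η ((0 : Site 4 8), ⟨(0, 1), h01⟩)))).trace.re) with hn0def
  set n1 := ∑ η ∈ Img 4 8 G, Wt φ η *
    ((N : ℝ) - (ρ (Additive.toMul (η ((te 2 : Site 4 8), ⟨(0, 1), h01⟩)))).trace.re) with hn1def
  have hgn : ∀ a : Additive G, 0 ≤ (N : ℝ) - (ρ (Additive.toMul a)).trace.re := fun a =>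
    (gap_mem ρ hρu _).1
  have hnA0 : 0 ≤ nA := Finset.sum_nonneg fun η _ =>
    mul_nonneg (Wt_nonneg hφn η) (mul_nonneg (hgn _) (hgn _))
  have hn00 : 0 ≤ n0 := Finset.sum_nonneg fun η _ => mul_nonneg (Wt_nonneg hφn η) (hgn _)
  have hn10 : 0 ≤ n1 := Finset.sum_nonneg fun η _ => mul_nonneg (Wt_nonneg hφn η) (hgn _)
  have hnA' : nA ≤ 4 * (N : ℝ) ^ 2 * (Zc * (peierlsSum 4 8 lam 8 + peierlsSum 4 8 lam 5 ^ 2)) := by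
    have h := sum_Img_axis_le ρ hρu hφ0 hφn hε0.le hφε
    rw [← hA, ← hlam] at h
    exact h
  -- freeze the sums: pure real arithmetic from here on
  clear_value Zex Zc nA n0 n1
  clear eP0P1 eP0 eP1 hsing hPS hmin hgap hφε hgn
  set P5 := peierlsSum 4 8 lam 5 with hP5
  set P8 := peierlsSum 4 8 lam 8 with hP8
  have hP80 : 0 ≤ P8 := by rw [hP8]; exact peierlsSum_nonneg hlam0 8
  clear_value P5 P8
  have hl8 : lam ^ 8 = A ^ 8 * ε ^ 8 := by rw [hlam, mul_pow]
  have hl10 : lam ^ 10 ≤ A ^ 10 * ε ^ 8 := by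
    rw [hlam, mul_pow]
    exact mul_le_mul_of_nonneg_left (pow_le_pow_of_le_one hε0.le hε1 (by norm_num))
      (pow_nonneg hA0 _)
  have hsq : P5 ^ 2 ≤ (C5 * lam ^ 5) ^ 2 := pow_le_pow_left₀ hPS50 hPS5 2
  have hsq' : (C5 * lam ^ 5) ^ 2 = C5 ^ 2 * lam ^ 10 := by ring
  have h2 : P8 + P5 ^ 2 ≤ C8 * lam ^ 8 + C5 ^ 2 * lam ^ 10 := by linarith only [hPS8, hsq, hsq']
  have h3 : 0 ≤ P8 + P5 ^ 2 := add_nonneg hP80 (sq_nonneg _)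
  have hZW : Zc * (P8 + P5 ^ 2) ≤ 2 * (C8 * lam ^ 8 + C5 ^ 2 * lam ^ 10) :=
    mul_le_mul hZc2 h2 h3 (by norm_num)
  have h4N2 : 0 ≤ 4 * (N : ℝ) ^ 2 := by nlinarith only [sq_nonneg (N : ℝ)]
  have hnA : nA ≤ 8 * (N : ℝ) ^ 2 * (C8 * lam ^ 8 + C5 ^ 2 * lam ^ 10) := by
    have := mul_le_mul_of_nonneg_left hZW h4N2
    linarith only [hnA', this]
  have hEA : nA / Zex ≤ nA := div_le_self hnA0 hZex1
  have hE10 : 0 ≤ n1 / Zex := div_nonneg hn10 hZex0.le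
  have hE00 : 0 ≤ n0 / Zex := div_nonneg hn00 hZex0.le
  have hWε : C8 * lam ^ 8 + C5 ^ 2 * lam ^ 10 ≤ ε ^ 8 * (C8 * A ^ 8 + C5 ^ 2 * A ^ 10) := by
    rw [hl8]
    have := mul_le_mul_of_nonneg_left hl10 (sq_nonneg C5)
    nlinarith only [this]
  have h1 : nA / Zex - n0 / Zex * (n1 / Zex) ≤ nA := by
    have := mul_nonneg hE00 hE10
    linarith only [hEA, this]
  have h8N : 0 ≤ 8 * (N : ℝ) ^ 2 := by linarith only [h4N2]
  have hfin : nA ≤ ε ^ 8 * (8 * (N : ℝ) ^ 2 * (C8 * A ^ 8 + C5 ^ 2 * A ^ 10)) := by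
    have := mul_le_mul_of_nonneg_left hWε h8N
    linarith only [hnA, this]
  linarith only [h1, hfin]

end Finite

/-- **`ConnectedSpace G` is load-bearing for `stub_axisLower`.** The statement below is the
conclusion `AxisLowerFixedTorus` of the line's stub `stub_axisLower`
(`Cruxes/FemtoCurvatureTwoPoint/Lines/generic-step-gamma-encoding.lean`) with the hypothesis
`IsCompactSimpleLieGroup G` weakened to `Nontrivial G`, everything else verbatim — and it is
FALSE: witness `ℤ₂ = rootsOfUnityCircle 2` with its (faithful, unitary, continuous) defining
character `znRep 2`, the torus `L = 8` and `n = 1`, where `β² Cov_β ≤ β² M e^{-8βδ} → 0 < c`. -/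
theorem not_axisLowerFixedTorus_nontrivial :
    ¬ (∀ (G : Type) [Group G] [TopologicalSpace G] [IsTopologicalGroup G] [CompactSpace G],
      Nontrivial G →
      letI : MeasurableSpace G := borel G
      haveI : BorelSpace G := ⟨rfl⟩
      ∀ (r : LatticeRep G), ∃ (B : ℕ → ℝ) (c : ℝ), 0 < c ∧
        ∀ (L : ℕ) [NeZero L] (β : ℝ), B L ≤ β →
          let P : (Fin 4 → ZMod L) → Fin 4 → Fin 4 → GaugeConfig 4 L G → ℝ :=
            fun x i j U => (r.N : ℝ) - (r.ρ (plaquetteHolonomy U x i j)).trace.re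
          let E : (GaugeConfig 4 L G → ℝ) → ℝ := fun F => wilsonExpectation (d := 4) (L := L) r.ρ β F
          let cov : (GaugeConfig 4 L G → ℝ) → (GaugeConfig 4 L G → ℝ) → ℝ :=
            fun F F' => E (fun U => F U * F' U) - E F * E F'
          ∀ n : ℕ, 1 ≤ n → 8 * n ≤ L →
            c ≤ β ^ 2 * ((n : ℝ) ^ 8 *
              cov (P 0 0 1) (P (Pi.single (2 : Fin 4) ((n : ℕ) : ZMod L)) 0 1))) := by
  intro h
  classical
  haveI : Fact (2 ≤ 2) := ⟨le_rfl⟩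
  haveI : NeZero (8 : ℕ) := ⟨by norm_num⟩
  haveI : Fintype (rootsOfUnityCircle 2) := Fintype.ofFinite _
  letI : MeasurableSpace (rootsOfUnityCircle 2) := borel _
  haveI : BorelSpace (rootsOfUnityCircle 2) := ⟨rfl⟩
  let r : LatticeRep (rootsOfUnityCircle 2) :=
    ⟨1, znRep 2, continuous_znRep 2, znRep_injective 2, znRep_mem_unitaryGroup 2⟩
  obtain ⟨B, c, hc, H⟩ := h (rootsOfUnityCircle 2) inferInstance r
  -- the stub at `L = 8`, `n = 1`
  have H8 : ∀ β : ℝ, B 8 ≤ β → c ≤ β ^ 2 * (((1 : ℕ) : ℝ) ^ 8 *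
      (wilsonExpectation (d := 4) (L := 8) (znRep 2) β (fun U =>
          (((1 : ℕ) : ℝ) - ((znRep 2) (plaquetteHolonomy U (0 : Site 4 8) 0 1)).trace.re) *
            (((1 : ℕ) : ℝ) - ((znRep 2) (plaquetteHolonomy U
              (Pi.single (2 : Fin 4) (((1 : ℕ) : ℕ) : ZMod 8)) 0 1)).trace.re)) -
        wilsonExpectation (d := 4) (L := 8) (znRep 2) β (fun U =>
            ((1 : ℕ) : ℝ) - ((znRep 2) (plaquetteHolonomy U (0 : Site 4 8) 0 1)).trace.re) *
          wilsonExpectation (d := 4) (L := 8) (znRep 2) β (fun U => ((1 : ℕ) : ℝ) -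
            ((znRep 2) (plaquetteHolonomy U (Pi.single (2 : Fin 4) (((1 : ℕ) : ℕ) : ZMod 8))
              0 1)).trace.re))) := by
    intro β hβ
    have := H 8 β hβ 1 le_rfl (by norm_num)
    exact this
  obtain ⟨M, δ, hδ, hev⟩ := eventually_axisCov_le (G := rootsOfUnityCircle 2) (N := 1) (znRep 2)
    (znRep_mem_unitaryGroup 2) (znRep_injective 2)
  -- `β² M ε⁸ → 0`
  have hlim : Tendsto (fun β : ℝ => β ^ 2 * (M * Real.exp (-(β * δ)) ^ 8)) atTop (𝓝 0) := by
    have hg : ∀ β : ℝ, β ^ 2 * (M * Real.exp (-(β * δ)) ^ 8) =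
        (M / (8 * δ) ^ 2) * ((8 * δ * β) ^ 2 * Real.exp (-(8 * δ * β))) := by
      intro β
      have hδ' : δ ≠ 0 := hδ.ne'
      have e : Real.exp (-(β * δ)) ^ 8 = Real.exp (-(8 * δ * β)) := by
        rw [← Real.exp_nat_mul]; congr 1; push_cast; ring
      rw [e]
      field_simp
    simp_rw [hg]
    have h1 : Tendsto (fun x : ℝ => x ^ 2 * Real.exp (-x)) atTop (𝓝 0) :=
      Real.tendsto_pow_mul_exp_neg_atTop_nhds_zero 2
    have h2 : Tendsto (fun β : ℝ => 8 * δ * β) atTop atTop :=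
      tendsto_id.const_mul_atTop (by positivity)
    simpa [Function.comp_def] using (h1.comp h2).const_mul (M / (8 * δ) ^ 2)
  have hevc : ∀ᶠ β : ℝ in atTop, β ^ 2 * (M * Real.exp (-(β * δ)) ^ 8) < c :=
    hlim (Iio_mem_nhds hc)
  obtain ⟨β, hβB, hβcov, hβc⟩ := ((eventually_ge_atTop (B 8)).and (hev.and hevc)).exists
  have h1 := H8 β hβB
  have e18 : ((1 : ℕ) : ℝ) ^ 8 = 1 := by norm_num
  rw [e18, one_mul] at h1
  have h3 := mul_le_mul_of_nonneg_left hβcov (sq_nonneg β)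
  linarith
end Summit.QuantumFields.YangMills.Theorems.FemtoCurvatureTwoPoint.Negative.AxisLowerFiniteGroup

end
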